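import Literature.RingTheory.FormalGroups.FormalOModuleBud
import HarnessLib

/-!
# Buds of formal `𝒪`-module laws, II: invariance under congruence `mod deg m+1`
# ([Lazard 1955] §I Lemme 1, §II; [Hazewinkel 1978] §5.7)

Topic `Literature/RingTheory/FormalGroups`; namespace `Literature.RingTheory.FormalGroups`.  Fully proved theorems; no
definition, no named fact, no instance, no notation, no `sorry`.  Cell `hodgecm-mathlib`, P6 «MOD programme», sub-line P6d.

The seven defect series of the sibling `FormalOModuleBud` are CONTINUOUS for congruences: if `F′ ≡ F` and `φ′ ≡ φ, …`
`(mod deg N)` (no constant terms) then `assocDefect F′ ≡ assocDefect F (mod deg N)`, etc. — Lazard's Lemme 1 (★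
`DegreeCongruence`) plus `order (f(a)) ≥ order f`.  Consequently bud-ness only depends on the data `mod deg m+1`
(`IsOModuleBud.congr`): this is what lets one replace a bud by a polynomial truncation, and an exact extension over `P ⊗ K`
by an integral one.

* `le_order_subst_of_le`, `le_order_psubst_of_le` — substitution does not lower the order (arguments without constant term).
* `le_order_assocDefect_sub`, `…commDefect…`, `…homDefect…`, `…addDefect…`, `…mulDefect…` — continuity of the defects.
* `IsOModuleBud.congr`.
-/

noncomputable section

namespace Literature.RingTheory.FormalGroups

open MvPowerSeries (HasSubst subst X order)

universe u v

variable {𝒪 : Type u} [CommRing 𝒪] {B : Type v} [CommRing B] [Algebra 𝒪 B]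

/-! ## §1 Substitution does not lower the order -/

/-- `order f ≤ order (f(a))` when the arguments have no constant term; congruence form `↑N ≤ f.order → ↑N ≤ (f.subst a).order`.
[cite: Lazard1955, §I Lemme 1] -/
theorem le_order_subst_of_le {σ τ : Type*} [Finite σ] [Nonempty σ] {N : ℕ} {f : MvPowerSeries σ B}
    (hf : (N : ℕ∞) ≤ f.order) {a : σ → MvPowerSeries τ B} (ha : ∀ i, MvPowerSeries.constantCoeff (a i) = 0) :
    (N : ℕ∞) ≤ (f.subst a).order := by
  have has := MvPowerSeries.hasSubst_of_constantCoeff_zero ha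
  refine hf.trans (le_trans ?_ (MvPowerSeries.le_order_subst has f))
  refine ENat.self_le_mul_left _ ?_
  refine (lt_of_lt_of_le zero_lt_one (le_iInf fun i => ?_)).ne'
  exact Order.one_le_iff_ne_zero.2 ((a i).order_ne_zero_iff_constCoeff_eq_zero.2 (ha i))

/-- Univariate form: `↑N ≤ order φ → ↑N ≤ order (φ(u))` for `u` without constant term. [cite: Lazard1955, §I Lemme 1] -/
theorem le_order_psubst_of_le {τ : Type*} {N : ℕ} {φ : PowerSeries B} (hφ : (N : ℕ∞) ≤ MvPowerSeries.order φ)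
    {u : MvPowerSeries τ B} (hu : MvPowerSeries.constantCoeff u = 0) : (N : ℕ∞) ≤ (PowerSeries.subst u φ).order := by
  have h := PowerSeries.le_order_subst_left (φ := φ) hu
  rw [PowerSeries.order_eq_order] at h
  exact hφ.trans h

/-! ## §2 Continuity of the defects -/

section Defects

variable {N : ℕ} {F F' : MvPowerSeries (Fin 2) B} {φ φ' ψ ψ' χ χ' : PowerSeries B}

/-- The constant coefficient of `F(u,v)` vanishes when `F`'s does (arguments without constant term). [folklore] -/
private theorem constantCoeff_subst_pair {τ : Type*} (hF : MvPowerSeries.constantCoeff F = 0) {u v : MvPowerSeries τ B}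
    (hu : MvPowerSeries.constantCoeff u = 0) (hv : MvPowerSeries.constantCoeff v = 0) :
    MvPowerSeries.constantCoeff (F.subst ![u, v]) = 0 :=
  MvPowerSeries.constantCoeff_subst_eq_zero (MvPowerSeries.hasSubst_of_constantCoeff_zero fun i => by fin_cases i <;> assumption)
    (fun i => by fin_cases i <;> assumption) hF

/-- Two-argument substitution is continuous in the outer series and the arguments:
`F′ ≡ F`, `u′ ≡ u`, `v′ ≡ v (mod deg N)` imply `F′(u′,v′) ≡ F(u,v) (mod deg N)`. [cite: Lazard1955, §I Lemme 1] -/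
theorem le_order_subst_pair_sub {τ : Type*} (hFF' : (N : ℕ∞) ≤ (F' - F).order) {u u' v v' : MvPowerSeries τ B}
    (hu : MvPowerSeries.constantCoeff u = 0) (hu' : MvPowerSeries.constantCoeff u' = 0)
    (hv : MvPowerSeries.constantCoeff v = 0) (hv' : MvPowerSeries.constantCoeff v' = 0)
    (huu' : (N : ℕ∞) ≤ (u' - u).order) (hvv' : (N : ℕ∞) ≤ (v' - v).order) :
    (N : ℕ∞) ≤ (F'.subst ![u', v'] - F.subst ![u, v]).order := by
  have ha' : ∀ i, MvPowerSeries.constantCoeff ((![u', v'] : Fin 2 → MvPowerSeries τ B) i) = 0 := fun i => by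
    fin_cases i <;> assumption
  have ha : ∀ i, MvPowerSeries.constantCoeff ((![u, v] : Fin 2 → MvPowerSeries τ B) i) = 0 := fun i => by
    fin_cases i <;> assumption
  have h1 : (N : ℕ∞) ≤ (F'.subst ![u', v'] - F.subst ![u', v']).order := by
    rw [← MvPowerSeries.subst_sub (MvPowerSeries.hasSubst_of_constantCoeff_zero ha')]
    exact le_order_subst_of_le hFF' ha'
  have h2 : (N : ℕ∞) ≤ (F.subst ![u', v'] - F.subst ![u, v]).order :=
    le_order_subst_sub_subst' ha' ha fun i => by fin_cases i <;> assumption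
  exact natCast_le_order_sub_trans h1 h2

/-- Univariate substitution is continuous: `φ′ ≡ φ`, `u′ ≡ u (mod deg N)` imply `φ′(u′) ≡ φ(u) (mod deg N)`.
[cite: Lazard1955, §I Lemme 1] -/
theorem le_order_psubst_sub {τ : Type*} (hφφ' : (N : ℕ∞) ≤ MvPowerSeries.order (φ' - φ)) {u u' : MvPowerSeries τ B}
    (hu : MvPowerSeries.constantCoeff u = 0) (hu' : MvPowerSeries.constantCoeff u' = 0)
    (huu' : (N : ℕ∞) ≤ (u' - u).order) :
    (N : ℕ∞) ≤ (PowerSeries.subst u' φ' - PowerSeries.subst u φ).order := by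
  have h1 : (N : ℕ∞) ≤ (PowerSeries.subst u' φ' - PowerSeries.subst u' φ).order := by
    rw [← PowerSeries.subst_sub (PowerSeries.HasSubst.of_constantCoeff_zero hu')]
    exact le_order_psubst_of_le hφφ' hu'
  exact natCast_le_order_sub_trans h1 (le_order_psubst_sub_psubst' φ hu' hu huu')

/-- Continuity of the associativity defect. [cite: Lazard1955, §I Lemme 1] -/
theorem le_order_assocDefect_sub (hF : MvPowerSeries.constantCoeff F = 0) (hF' : MvPowerSeries.constantCoeff F' = 0)
    (hFF' : (N : ℕ∞) ≤ (F' - F).order) : (N : ℕ∞) ≤ (assocDefect F' - assocDefect F).order := by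
  have hX : ∀ i : Fin 3, MvPowerSeries.constantCoeff (X i : MvPowerSeries (Fin 3) B) = 0 := fun i =>
    MvPowerSeries.constantCoeff_X i
  have hrefl : ∀ i : Fin 3, (N : ℕ∞) ≤ ((X i : MvPowerSeries (Fin 3) B) - X i).order := fun i => by simp
  rw [assocDefect, assocDefect, sub_sub_sub_comm]
  refine natCast_le_order_sub ?_ ?_
  · exact le_order_subst_pair_sub hFF' (constantCoeff_subst_pair hF (hX 0) (hX 1))
      (constantCoeff_subst_pair hF' (hX 0) (hX 1)) (hX 2) (hX 2)
      (le_order_subst_pair_sub hFF' (hX 0) (hX 0) (hX 1) (hX 1) (hrefl 0) (hrefl 1)) (hrefl 2)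
  · exact le_order_subst_pair_sub hFF' (hX 0) (hX 0) (constantCoeff_subst_pair hF (hX 1) (hX 2))
      (constantCoeff_subst_pair hF' (hX 1) (hX 2)) (hrefl 0)
      (le_order_subst_pair_sub hFF' (hX 1) (hX 1) (hX 2) (hX 2) (hrefl 1) (hrefl 2))

/-- Continuity of the commutativity defect. [cite: Lazard1955, §I Lemme 1] -/
theorem le_order_commDefect_sub (hFF' : (N : ℕ∞) ≤ (F' - F).order) :
    (N : ℕ∞) ≤ (commDefect F' - commDefect F).order := by
  have hX : ∀ i : Fin 2, MvPowerSeries.constantCoeff (X i : MvPowerSeries (Fin 2) B) = 0 := fun i =>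
    MvPowerSeries.constantCoeff_X i
  rw [commDefect, commDefect, sub_sub_sub_comm]
  refine natCast_le_order_sub hFF' ?_
  exact le_order_subst_pair_sub hFF' (hX 1) (hX 1) (hX 0) (hX 0) (by simp) (by simp)

/-- Continuity of the homomorphism defect. [cite: Lazard1955, §I Lemme 1] -/
theorem le_order_homDefect_sub (hF : MvPowerSeries.constantCoeff F = 0) (hF' : MvPowerSeries.constantCoeff F' = 0)
    (hφ : PowerSeries.constantCoeff φ = 0) (hφ' : PowerSeries.constantCoeff φ' = 0)
    (hFF' : (N : ℕ∞) ≤ (F' - F).order) (hφφ' : (N : ℕ∞) ≤ MvPowerSeries.order (φ' - φ)) :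
    (N : ℕ∞) ≤ (homDefect F' φ' - homDefect F φ).order := by
  have hX : ∀ i : Fin 2, MvPowerSeries.constantCoeff (X i : MvPowerSeries (Fin 2) B) = 0 := fun i =>
    MvPowerSeries.constantCoeff_X i
  have hc : ∀ (ψ : PowerSeries B), PowerSeries.constantCoeff ψ = 0 → ∀ i : Fin 2,
      MvPowerSeries.constantCoeff (PowerSeries.subst (X i : MvPowerSeries (Fin 2) B) ψ) = 0 :=
    fun ψ hψ i => PowerSeries.constantCoeff_subst_eq_zero (hX i) ψ hψ
  rw [homDefect, homDefect, sub_sub_sub_comm]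
  refine natCast_le_order_sub (le_order_psubst_sub hφφ' hF hF' hFF') ?_
  exact le_order_subst_pair_sub hFF' (hc φ hφ 0) (hc φ' hφ' 0) (hc φ hφ 1) (hc φ' hφ' 1)
    (le_order_psubst_sub hφφ' (hX 0) (hX 0) (by simp)) (le_order_psubst_sub hφφ' (hX 1) (hX 1) (by simp))

/-- Continuity of the additivity defect. [cite: Lazard1955, §I Lemme 1] -/
theorem le_order_addDefect_sub (hφ : PowerSeries.constantCoeff φ = 0) (hφ' : PowerSeries.constantCoeff φ' = 0)
    (hψ : PowerSeries.constantCoeff ψ = 0) (hψ' : PowerSeries.constantCoeff ψ' = 0)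
    (hFF' : (N : ℕ∞) ≤ (F' - F).order) (hφφ' : (N : ℕ∞) ≤ MvPowerSeries.order (φ' - φ))
    (hψψ' : (N : ℕ∞) ≤ MvPowerSeries.order (ψ' - ψ)) (hχχ' : (N : ℕ∞) ≤ MvPowerSeries.order (χ' - χ)) :
    (N : ℕ∞) ≤ MvPowerSeries.order (addDefect F' φ' ψ' χ' - addDefect F φ ψ χ) := by
  rw [addDefect, addDefect, sub_sub_sub_comm]
  exact natCast_le_order_sub hχχ' (le_order_subst_pair_sub hFF' hφ hφ' hψ hψ' hφφ' hψψ')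

/-- Continuity of the multiplicativity defect. [cite: Lazard1955, §I Lemme 1] -/
theorem le_order_mulDefect_sub (hψ : PowerSeries.constantCoeff ψ = 0) (hψ' : PowerSeries.constantCoeff ψ' = 0)
    (hφφ' : (N : ℕ∞) ≤ MvPowerSeries.order (φ' - φ)) (hψψ' : (N : ℕ∞) ≤ MvPowerSeries.order (ψ' - ψ))
    (hχχ' : (N : ℕ∞) ≤ MvPowerSeries.order (χ' - χ)) :
    (N : ℕ∞) ≤ MvPowerSeries.order (mulDefect φ' ψ' χ' - mulDefect φ ψ χ) := by
  rw [mulDefect, mulDefect, sub_sub_sub_comm]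
  exact natCast_le_order_sub hχχ' (le_order_psubst_sub hφφ' hψ hψ' hψψ')

end Defects

/-! ## §3 Bud-ness is invariant under congruence -/

/-- **Invariance of bud-ness under congruence `mod deg m+1`** (`m ≥ 1`): if `(F, ρ)` is an `m`-bud and `F′ ≡ F`,
`ρ′_a ≡ ρ_a (mod deg m+1)` with `F′`, `ρ′_a` without constant terms, then `(F′, ρ′)` is an `m`-bud.
[cite: Lazard1955, §II (bourgeons)] [cite: Hazewinkel1978, §5.7] -/
theorem IsOModuleBud.congr {m : ℕ} (hm : 1 ≤ m) {F F' : MvPowerSeries (Fin 2) B} {ρ ρ' : 𝒪 → PowerSeries B}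
    (h : IsOModuleBud 𝒪 m F ρ) (hF' : MvPowerSeries.constantCoeff F' = 0)
    (hρ' : ∀ a, PowerSeries.constantCoeff (ρ' a) = 0) (hFF' : ((m + 1 : ℕ) : ℕ∞) ≤ (F' - F).order)
    (hρρ' : ∀ a, ((m + 1 : ℕ) : ℕ∞) ≤ MvPowerSeries.order (ρ' a - ρ a)) : IsOModuleBud 𝒪 m F' ρ' where
  constantCoeff_F := hF'
  two_le_order_F := by
    have e : F' - X 0 - X 1 = (F' - F) + (F - X 0 - X 1) := by ring
    rw [e]
    exact natCast_le_order_add (natCast_le_order_of_le hFF' (by omega)) h.two_le_order_F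
  constantCoeff_ρ := hρ'
  coeff_one_ρ := fun a => by
    have h1 := (natCast_le_order_sub_iff.1 (hρρ' a)) (Finsupp.single () 1)
      (by rw [Finsupp.degree_single]; omega)
    rw [← h.coeff_one_ρ a]
    exact h1
  assoc := by
    have := natCast_le_order_add (le_order_assocDefect_sub h.constantCoeff_F hF' hFF') h.assoc
    rwa [sub_add_cancel] at this
  comm := by
    have := natCast_le_order_add (le_order_commDefect_sub hFF') h.comm
    rwa [sub_add_cancel] at this
  hom := fun a => by
    have := natCast_le_order_add
      (le_order_homDefect_sub h.constantCoeff_F hF' (h.constantCoeff_ρ a) (hρ' a) hFF' (hρρ' a)) (h.hom a)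
    rwa [sub_add_cancel] at this
  add := fun a b => by
    have := natCast_le_order_add (le_order_addDefect_sub (h.constantCoeff_ρ a) (hρ' a) (h.constantCoeff_ρ b) (hρ' b)
      hFF' (hρρ' a) (hρρ' b) (hρρ' (a + b))) (h.add a b)
    rwa [sub_add_cancel] at this
  mul := fun a b => by
    have := natCast_le_order_add (le_order_mulDefect_sub (h.constantCoeff_ρ b) (hρ' b) (hρρ' a) (hρρ' b)
      (hρρ' (a * b))) (h.mul a b)
    rwa [sub_add_cancel] at this
  one := by
    have := natCast_le_order_add (hρρ' 1) h.one
    rwa [sub_add_sub_cancel] at this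
  zero := by
    have := natCast_le_order_add (hρρ' 0) h.zero
    rwa [sub_add_cancel] at this

end Literature.RingTheory.FormalGroups
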